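import Mathlib

/-!
# p1 — the certificate predicate for Shioda's per-class criterion (proofs/p1-lattice-calculus.md §4d)

`IsShiodaCert m Phi S alpha blocks` bundles the finite checks behind one application of Shioda 1981 Thm 4.3 to an abelian
variety of CM type (ℚ(ζ_m), Φ), Φ = Φ_(a,b) a Fermat type with α = (a, b, −a−b), and a balanced family S of eigenlines
(units of ℤ/m): (1) Φ is a CM type on (ℤ/m)^×; (2) S is balanced (|S ∩ tΦ| = |S|/2 for every unit t); (3) α is a zero-sum
triple; (4) the multiset γ = ∏_(u∈S) u·α of residues equals the union of the blocks; (5) every block is elementary: zero-sum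
mod m, of Hodge weight |block|/2 under every unit t (Σ (t·x mod m) = (|block|/2)·m), and a pair, a quadruple, or a sextuple
containing a zero-sum triple through its first element. A decided instance certifies, with Shioda 1981 Lemma 4.2 + Thm 4.3,
that the orbit piece of S consists of algebraic classes.
-/

namespace HodgeRepro0.P1.FermatCert

/-- the units of ℤ/m, listed as naturals 0 < t < m with gcd(t,m) = 1 -/
def unitsOf (m : ℕ) : List ℕ := (List.range m).filter (fun t => 0 < t ∧ Nat.gcd t m = 1)

/-- the certificate predicate (decidable by `decide` for concrete data) -/
abbrev IsShiodaCert (m : ℕ) (Phi S alpha : List ℕ) (blocks : List (List ℕ)) : Prop :=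
  (∀ t ∈ unitsOf m, (t ∈ Phi) ≠ ((m - t) ∈ Phi)) ∧
  (∀ t ∈ unitsOf m, 2 * (S.filter (fun s => (Phi.map (fun x => t * x % m)).contains s)).length = S.length) ∧
  (alpha.length = 3 ∧ alpha.sum % m = 0) ∧
  ((((S.map (fun u => alpha.map (fun x => u * x % m))).flatten : List ℕ) : Multiset ℕ) =
      ((blocks.flatten : List ℕ) : Multiset ℕ)) ∧
  (∀ bk ∈ blocks, bk.sum % m = 0 ∧
      (∀ t ∈ unitsOf m, (bk.map (fun x => t * x % m)).sum = (bk.length / 2) * m) ∧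
      (bk.length = 2 ∨ bk.length = 4 ∨
        (bk.length = 6 ∧ ∃ i ∈ [1, 2, 3, 4, 5], ∃ j ∈ [1, 2, 3, 4, 5], i < j ∧
          (bk.headD 0 + bk.getD i 0 + bk.getD j 0) % m = 0)))

/-- sanity instance: the ℚ(ζ_21) class-F certificate of (X19) -/
theorem zeta21_classF :
    IsShiodaCert 21 [1, 2, 4, 5, 8, 10] [1, 4, 10, 13, 16, 19] [1, 1, 19]
      [[1, 19, 4, 13, 10, 16], [1, 4, 10, 13, 16, 19], [1, 13, 16, 10, 19, 4]] := by decide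

end HodgeRepro0.P1.FermatCert
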